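import Summits.RiemannHypothesis.RiemannHypothesis.Theorems.NymanBeurlingDilateZeroSumExplicit
import Literature.NumberTheory.LFunctions.FordZetaZeroRecipSqSum
import Mathlib.Analysis.Normed.Group.InfiniteSum
import HarnessLib

/-!
# RiemannHypothesis / Nyman–Beurling — a UNIFORM EXPLICIT BOUND for the dilate zero sums and their prime side:
# `|S(n)| < 0.0463` for every `n ≥ 1`, hence `|nbDilatePrimeSide n| < 0.0463` for every `n ≥ 2` (RH-FREE)

Corollary of T7 (`NymanBeurlingDilateZeroSumExplicit.lean`) and of Ford's bound `Σ_ρ m_ρ/|ρ|² < 0.0462`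
(`Literature.NumberTheory.LFunctions.tsum_zeroOrder_div_norm_sq_lt`, `…tsum_zeroOrder_div_norm_one_sub_sq_le`):
`|n^{−ρ}| ≤ 1` and `1/(|ρ||1−ρ|) ≤ (1/|ρ|² + 1/|1−ρ|²)/2` give `|S(n)| ≤ ½(Σ m/|ρ|² + Σ m/|1−ρ|²) < 0.0463` uniformly;
by T7 this is the unconditional, uniform-in-`n` inequality
`|(Σ_{m≤n} Λ(m)/m − log n + γ) − (ψ(n) − n)/n + (1 − log 2π)/n − (1/2n) log(1 − n⁻²) − ½ log((n+1)/(n−1))| < 0.0463`, `n ≥ 2`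
(`abs_nbDilatePrimeSide_lt`).  RH-FREE [rh-li-eng-3 g5]; nothing here bears on the truth of RH.
-/

noncomputable section

set_option linter.dupNamespace false

open Filter Set Topology
open scoped Real

namespace Summit.RiemannHypothesis.RiemannHypothesis.Theorems.NbTheory

open Literature.NumberTheory.LFunctions

namespace DilateExplicit

/-- AM–GM for the zero weights: `‖m/(ρ(1−ρ))‖ ≤ (m/|ρ|² + m/|1−ρ|²)/2`. -/
lemma norm_zeroTerm_le_half (ρ : ZetaZeros.riemannZetaNontrivialZeros) :
    ‖(riemannZetaZeroOrder (ρ : ℂ) : ℂ) / ((ρ : ℂ) * (1 - ρ))‖ ≤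
      ((riemannZetaZeroOrder (ρ : ℂ) : ℝ) / ‖(ρ : ℂ)‖ ^ 2 +
        (riemannZetaZeroOrder (ρ : ℂ) : ℝ) / ‖1 - (ρ : ℂ)‖ ^ 2) / 2 := by
  have hm : (0 : ℝ) < riemannZetaZeroOrder (ρ : ℂ) := zeroOrder_pos ρ
  have ha : 0 < ‖(ρ : ℂ)‖ := norm_pos_iff.2 (ne_zero_of_mem ρ.2)
  have hb : 0 < ‖1 - (ρ : ℂ)‖ := norm_pos_iff.2 (one_sub_ne_zero_of_mem ρ.2)
  rw [norm_div, norm_mul, norm_zeroOrder]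
  rw [div_add_div _ _ (pow_ne_zero 2 ha.ne') (pow_ne_zero 2 hb.ne'), div_div,
    div_le_div_iff₀ (mul_pos ha hb) (by positivity)]
  have key : 0 ≤ (riemannZetaZeroOrder (ρ : ℂ) : ℝ) * ‖(ρ : ℂ)‖ * ‖1 - (ρ : ℂ)‖ *
      (‖(ρ : ℂ)‖ - ‖1 - (ρ : ℂ)‖) ^ 2 :=
    mul_nonneg (mul_nonneg (mul_nonneg hm.le ha.le) hb.le) (sq_nonneg _)
  nlinarith [key]

end DilateExplicit

open DilateExplicit

/-- **`|S(n)| < 0.0463` for every `n ≥ 1`** (RH-FREE; `|n^{−ρ}| ≤ 1`, AM–GM, Ford's `Σ m/|ρ|² < 0.0462` and its reflection). -/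
theorem norm_nbDilateZeroSum_lt {n : ℕ} (hn : 1 ≤ n) : ‖nbDilateZeroSum n‖ < 0.0463 := by
  have hn0 : 0 < n := hn
  -- summable majorant `‖m/(ρ(1−ρ))‖`
  have hS : Summable fun ρ : ZetaZeros.riemannZetaNontrivialZeros ↦
      ‖(riemannZetaZeroOrder (ρ : ℂ) : ℂ) / ((ρ : ℂ) * (1 - ρ))‖ :=
    summable_norm_zeroOrder_div_mul_one_sub
  -- termwise: `‖m n^{−ρ}/(ρ(1−ρ))‖ ≤ ‖m/(ρ(1−ρ))‖`
  have hle : ∀ ρ : ZetaZeros.riemannZetaNontrivialZeros,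
      ‖(riemannZetaZeroOrder (ρ : ℂ) : ℂ) * (n : ℂ) ^ (-(ρ : ℂ)) / ((ρ : ℂ) * (1 - (ρ : ℂ)))‖ ≤
        ‖(riemannZetaZeroOrder (ρ : ℂ) : ℂ) / ((ρ : ℂ) * (1 - ρ))‖ := by
    intro ρ
    have hre : 0 < (ρ : ℂ).re := ZetaZeros.riemannZetaNontrivialZeros.re_pos ρ.2
    have hpow : ‖(n : ℂ) ^ (-(ρ : ℂ))‖ ≤ 1 := by
      rw [Complex.norm_natCast_cpow_of_pos hn0, Complex.neg_re]
      exact Real.rpow_le_one_of_one_le_of_nonpos (by exact_mod_cast hn) (by linarith)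
    rw [norm_div, norm_mul, norm_div]
    have h0 : 0 ≤ ‖(riemannZetaZeroOrder (ρ : ℂ) : ℂ)‖ := norm_nonneg _
    have h1 : 0 ≤ ‖(ρ : ℂ) * (1 - ρ)‖ := norm_nonneg _
    calc ‖(riemannZetaZeroOrder (ρ : ℂ) : ℂ)‖ * ‖(n : ℂ) ^ (-(ρ : ℂ))‖ / ‖(ρ : ℂ) * (1 - (ρ : ℂ))‖
        ≤ ‖(riemannZetaZeroOrder (ρ : ℂ) : ℂ)‖ * 1 / ‖(ρ : ℂ) * (1 - (ρ : ℂ))‖ :=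
          div_le_div_of_nonneg_right (mul_le_mul_of_nonneg_left hpow h0) h1
      _ = ‖(riemannZetaZeroOrder (ρ : ℂ) : ℂ)‖ / ‖(ρ : ℂ) * (1 - (ρ : ℂ))‖ := by rw [mul_one]
  have hSn : Summable fun ρ : ZetaZeros.riemannZetaNontrivialZeros ↦
      ‖(riemannZetaZeroOrder (ρ : ℂ) : ℂ) * (n : ℂ) ^ (-(ρ : ℂ)) / ((ρ : ℂ) * (1 - (ρ : ℂ)))‖ :=
    hS.of_nonneg_of_le (fun ρ ↦ norm_nonneg _) hle
  -- the two Ford sums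
  have hF1 := tsum_zeroOrder_div_norm_sq_lt
  have hF2 := tsum_zeroOrder_div_norm_one_sub_sq_le
  have hsum1 : Summable fun ρ : ZetaZeros.riemannZetaNontrivialZeros ↦
      (riemannZetaZeroOrder (ρ : ℂ) : ℝ) / ‖(ρ : ℂ)‖ ^ 2 := FordL33.summable_order_div_norm_sq
  have hsum2 : Summable fun ρ : ZetaZeros.riemannZetaNontrivialZeros ↦
      (riemannZetaZeroOrder (ρ : ℂ) : ℝ) / ‖1 - (ρ : ℂ)‖ ^ 2 := by
    have h : ∀ ρ : RHWave0.riemannZetaNontrivialZeros,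
        (riemannZetaZeroOrder (ρ : ℂ) : ℝ) / ‖1 - (ρ : ℂ)‖ ^ 2 =
          (riemannZetaZeroOrder ((FordL33.reflEquiv ρ : RHWave0.riemannZetaNontrivialZeros) : ℂ) : ℝ)
            / ‖((FordL33.reflEquiv ρ : RHWave0.riemannZetaNontrivialZeros) : ℂ)‖ ^ 2 := by
      intro ρ
      simp only [FordL33.reflEquiv, Function.Involutive.coe_toPerm]
      rw [FordL33.order_refl, FordL33.norm_refl]
    have h2 := (FordL33.reflEquiv.summable_iff.2 hsum1)
    exact h2.congr fun ρ ↦ (h ρ).symm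
  calc ‖nbDilateZeroSum n‖
      ≤ ∑' ρ : ZetaZeros.riemannZetaNontrivialZeros,
          ‖(riemannZetaZeroOrder (ρ : ℂ) : ℂ) * (n : ℂ) ^ (-(ρ : ℂ)) / ((ρ : ℂ) * (1 - (ρ : ℂ)))‖ :=
        norm_tsum_le_tsum_norm hSn
    _ ≤ ∑' ρ : ZetaZeros.riemannZetaNontrivialZeros, ‖(riemannZetaZeroOrder (ρ : ℂ) : ℂ) / ((ρ : ℂ) * (1 - ρ))‖ :=
        hSn.tsum_le_tsum hle hS
    _ ≤ ∑' ρ : ZetaZeros.riemannZetaNontrivialZeros, ((riemannZetaZeroOrder (ρ : ℂ) : ℝ) / ‖(ρ : ℂ)‖ ^ 2 +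
          (riemannZetaZeroOrder (ρ : ℂ) : ℝ) / ‖1 - (ρ : ℂ)‖ ^ 2) / 2 :=
        hS.tsum_le_tsum norm_zeroTerm_le_half ((hsum1.add hsum2).div_const 2)
    _ = ((∑' ρ : ZetaZeros.riemannZetaNontrivialZeros, (riemannZetaZeroOrder (ρ : ℂ) : ℝ) / ‖(ρ : ℂ)‖ ^ 2) +
          ∑' ρ : ZetaZeros.riemannZetaNontrivialZeros, (riemannZetaZeroOrder (ρ : ℂ) : ℝ) / ‖1 - (ρ : ℂ)‖ ^ 2) / 2 := by
        rw [tsum_div_const, hsum1.tsum_add hsum2]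
    _ < 0.0463 := by
        have h1 : (∑' ρ : ZetaZeros.riemannZetaNontrivialZeros, (riemannZetaZeroOrder (ρ : ℂ) : ℝ) / ‖(ρ : ℂ)‖ ^ 2)
            < 0.0462 := hF1
        have h2 : (∑' ρ : ZetaZeros.riemannZetaNontrivialZeros,
            (riemannZetaZeroOrder (ρ : ℂ) : ℝ) / ‖1 - (ρ : ℂ)‖ ^ 2) ≤ 0.0463 := hF2
        linarith

/-- **`|nbDilatePrimeSide n| < 0.0463` for every `n ≥ 2`** (RH-FREE), i.e. the uniform explicit inequality
`|(Σ_{m≤n} Λ(m)/m − log n + γ) − (ψ(n) − n)/n + (1 − log 2π)/n − (1/2n) log(1 − n⁻²) − ½ log((n+1)/(n−1))| < 0.0463`. -/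
theorem abs_nbDilatePrimeSide_lt {n : ℕ} (hn : 2 ≤ n) : |nbDilatePrimeSide n| < 0.0463 := by
  have h := norm_nbDilateZeroSum_lt (by omega : 1 ≤ n)
  rwa [nbDilateZeroSum_eq_nbDilatePrimeSide hn, Complex.norm_real, Real.norm_eq_abs] at h

end Summit.RiemannHypothesis.RiemannHypothesis.Theorems.NbTheory

end
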